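import Mathlib

/-!
# O5 — orientation at 9 of conductor-3 Heegner forms on `X₀(9M)`: the STRICT / MIXED dichotomy (mod-3 arithmetic)

Cell `b2b-bsdres`, lane CLASS-CLOSURE, instrument builder cc-eng-5 GEN 49 (engine `kl3log.gp` v0.2/v0.3, HOME
`class-closure/eng-5/dev-kl3log-v02/README.md` § "ORIENTATION AT 9"; o5-r2 `gen16/D-KL3-1.md` §3–§4 (i)).

HONEST FRAMING (cell rule, verbatim in every file): the goal of the cell is to DELETE the COMBINATION-SHAPED residual
classes of the Birch–Swinnerton-Dyer formula for ALL analytic-rank `≤ 1` elliptic curves over `ℚ` — "full BSD formula for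
every rank `≤ 1` curve in class `C`" assembled STRICTLY from published theorems — so that the rank-`≤ 1` remainder becomes
exactly the CONSTRUCTION-SHAPED classes, which are TYPED (missing-input `Prop`s), NOT attempted. This is not "finishing
BSD". This file is pure elementary arithmetic supporting an INSTRUMENT's convention; it asserts nothing about any curve,
L-function or Selmer group; nothing is booked; no `RESIDUAL-MAP.md` mark moves.

WHAT IS PROVED. Let `N = 9M` with `3 ∤ M`, let `D ≡ 1 (mod 3)` (a discriminant in which `3` splits), and consider a binary
quadratic form `(a·N, B, C)` of discriminant `B² − 4·(aN)·C = 9D` with `B = 3B'` (every orientation `β` with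
`β² ≡ 9D (mod 4N)` is divisible by `3`). Writing the discriminant identity as `B'² − 4·M·a·C = D`:
* if `3 ∣ B'` then `3 ∤ a` and `3 ∤ C` (the "STRICT" orientation class: both lattices `[1, τ]` and `[1, Nτ]` keep
  complex multiplication by the order of conductor `3`);
* if `3 ∤ B'` and the form is primitive at `3` (i.e. `3 ∤ C`, the only way `gcd(aN, B, C)` can avoid `3`), then `3 ∣ a`
  (the "MIXED" class: the `N`-isogenous lattice `[1, Nτ]` has the form `(a, B, C·N)` with all coefficients divisible by `3`).
The content is a finite check in `ZMod 3` (`b² − m·a·c = 1`, `m ≠ 0`), transported to `ℤ`.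
-/

namespace Summit.BirchSwinnertonDyer.Rank1Residual.O5.HeegnerOrientationAtNine

/-- The mod-3 core: for `m ≠ 0` in `ZMod 3` and `b² − 4·m·a·c = 1`, either `b = 0` and then `a ≠ 0 ∧ c ≠ 0`,
or `b ≠ 0` and then `a = 0 ∨ c = 0`. (81 cases, decided.) -/
theorem zmod3_core :
    ∀ m a b c : ZMod 3, m ≠ 0 → b ^ 2 - 4 * m * a * c = 1 →
      (b = 0 → a ≠ 0 ∧ c ≠ 0) ∧ (b ≠ 0 → a = 0 ∨ c = 0) := by
  decide

/-- Casting helper: an integer is divisible by `3` iff its image in `ZMod 3` vanishes. -/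
theorem intCast_eq_zero_iff (x : ℤ) : ((x : ZMod 3) = 0) ↔ (3 : ℤ) ∣ x := by
  exact_mod_cast (ZMod.intCast_zmod_eq_zero_iff_dvd x 3)

/-- STRICT orientation class: with `3 ∤ M`, `D ≡ 1 (mod 3)` and the discriminant identity `B'² − 4·M·a·C = D`,
if `3 ∣ B'` then `3 ∤ a` and `3 ∤ C`. -/
theorem strict_of_three_dvd (M a B' C D : ℤ) (hM : ¬ (3 : ℤ) ∣ M) (hD : D % 3 = 1)
    (hdisc : B' ^ 2 - 4 * M * a * C = D) (hB : (3 : ℤ) ∣ B') :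
    ¬ (3 : ℤ) ∣ a ∧ ¬ (3 : ℤ) ∣ C := by
  have hD3 : ((D : ℤ) : ZMod 3) = 1 := by
    have hk : D = 3 * (D / 3) + 1 := by omega
    rw [hk]
    push_cast
    have h3 : (3 : ZMod 3) = 0 := by decide
    rw [h3]; simp
  have hcast : ((B' : ZMod 3)) ^ 2 - 4 * (M : ZMod 3) * (a : ZMod 3) * (C : ZMod 3) = 1 := by
    have := congrArg (fun z : ℤ => (z : ZMod 3)) hdisc
    simp only [Int.cast_sub, Int.cast_pow, Int.cast_mul, Int.cast_ofNat] at this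
    rw [this, hD3]
  have hm : (M : ZMod 3) ≠ 0 := fun h => hM ((intCast_eq_zero_iff M).mp h)
  have hb : (B' : ZMod 3) = 0 := (intCast_eq_zero_iff B').mpr hB
  obtain ⟨ha, hc⟩ := (zmod3_core (M : ZMod 3) (a : ZMod 3) (B' : ZMod 3) (C : ZMod 3) hm hcast).1 hb
  exact ⟨fun h => ha ((intCast_eq_zero_iff a).mpr h), fun h => hc ((intCast_eq_zero_iff C).mpr h)⟩

/-- MIXED orientation class: with `3 ∤ M`, `D ≡ 1 (mod 3)`, the discriminant identity `B'² − 4·M·a·C = D`,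
`3 ∤ B'` and primitivity at `3` in the form `3 ∤ C`, one has `3 ∣ a`. -/
theorem three_dvd_a_of_not_three_dvd (M a B' C D : ℤ) (hM : ¬ (3 : ℤ) ∣ M) (hD : D % 3 = 1)
    (hdisc : B' ^ 2 - 4 * M * a * C = D) (hB : ¬ (3 : ℤ) ∣ B') (hC : ¬ (3 : ℤ) ∣ C) :
    (3 : ℤ) ∣ a := by
  have hD3 : ((D : ℤ) : ZMod 3) = 1 := by
    have hk : D = 3 * (D / 3) + 1 := by omega
    rw [hk]
    push_cast
    have h3 : (3 : ZMod 3) = 0 := by decide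
    rw [h3]; simp
  have hcast : ((B' : ZMod 3)) ^ 2 - 4 * (M : ZMod 3) * (a : ZMod 3) * (C : ZMod 3) = 1 := by
    have := congrArg (fun z : ℤ => (z : ZMod 3)) hdisc
    simp only [Int.cast_sub, Int.cast_pow, Int.cast_mul, Int.cast_ofNat] at this
    rw [this, hD3]
  have hm : (M : ZMod 3) ≠ 0 := fun h => hM ((intCast_eq_zero_iff M).mp h)
  have hb : (B' : ZMod 3) ≠ 0 := fun h => hB ((intCast_eq_zero_iff B').mp h)
  rcases (zmod3_core (M : ZMod 3) (a : ZMod 3) (B' : ZMod 3) (C : ZMod 3) hm hcast).2 hb with ha | hc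
  · exact (intCast_eq_zero_iff a).mp ha
  · exact absurd ((intCast_eq_zero_iff C).mp hc) hC

/-- The dichotomy in one statement (under primitivity at `3`, i.e. `3 ∤ C` whenever `3 ∤ B'`):
`3 ∣ a ↔ ¬ 3 ∣ B'`. -/
theorem three_dvd_a_iff (M a B' C D : ℤ) (hM : ¬ (3 : ℤ) ∣ M) (hD : D % 3 = 1)
    (hdisc : B' ^ 2 - 4 * M * a * C = D) (hprim : ¬ (3 : ℤ) ∣ B' → ¬ (3 : ℤ) ∣ C) :
    (3 : ℤ) ∣ a ↔ ¬ (3 : ℤ) ∣ B' := by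
  constructor
  · intro ha hB
    exact (strict_of_three_dvd M a B' C D hM hD hdisc hB).1 ha
  · intro hB
    exact three_dvd_a_of_not_three_dvd M a B' C D hM hD hdisc hB (hprim hB)

end Summit.BirchSwinnertonDyer.Rank1Residual.O5.HeegnerOrientationAtNine
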